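import Mathlib
import Literature.Analysis.Calculus.RadialHardyTwoEdge

/-!
# Kernel-one far channels, V: Hardy's inequality along a ray with vanishing corner value

Helper file for `stub_kernelOneChannels` of line `crum-peeling-recessive-tower` (crux
`UniformPhotonSphereChannelsR`, stmt-FinalStateConjecture-14074).  For `f ∈ C¹(ℝ)` with
`f(x_f) = 0`, a continuous weight `V ≥ 0` of HARDY SIZE `(x − x_f)² V(x) ≤ K` on `(x_f, ∞)`, and
`f'², Vf²` integrable on `(x_f, ∞)`:

  `∫_{x_f}^∞ V f² ≤ 4K ∫_{x_f}^∞ f'²`        (`hardy_ray`).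

Proof: on `[x₁, x₂] ⊂ (x_f, ∞)` the interval Hardy inequality with the inner edge term
(`Literature.Analysis.Calculus.hardy_sq_interval_le`, after the shift `r = x − x_f`) gives
`∫_{x₁}^{x₂} f²/(x−x_f)² ≤ 2 f(x₁)²/(x₁ − x_f) + 4 ∫ f'²`; the edge term tends to `0` as
`x₁ → x_f⁺` because `f(x_f) = 0` and `f` is differentiable at `x_f`; then `x₂ → ∞`.
In the kernel-one estimate this is applied on the two null rays `C^±` to the trace
`f(x) = ψ(±(x − x_f), x)` of the solution with the static mode subtracted (`f(x_f) = 0`).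
-/

noncomputable section

-- the doubled `FinalStateConjecture.FinalStateConjecture` path component trips dupNamespace
set_option linter.dupNamespace false

namespace Summit.FinalStateConjecture.FinalStateConjecture.Theorems.CrumPeelingRecessiveTower

open MeasureTheory Set Filter Topology intervalIntegral Literature.Analysis.Calculus

/-- **Hardy's inequality along a ray with vanishing corner value.** See the module docstring. -/
theorem hardy_ray {V f f' : ℝ → ℝ} {xf K : ℝ} (hV : Continuous V) (hV0 : ∀ x, 0 ≤ V x)
    (hVK : ∀ x, xf < x → (x - xf) ^ 2 * V x ≤ K)
    (hf : ∀ x, HasDerivAt f (f' x) x) (hf'c : Continuous f') (hf0 : f xf = 0)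
    (hiA : IntegrableOn (fun x => f' x ^ 2) (Ioi xf))
    (hiB : IntegrableOn (fun x => V x * f x ^ 2) (Ioi xf)) :
    ∫ x in Ioi xf, V x * f x ^ 2 ≤ 4 * K * ∫ x in Ioi xf, f' x ^ 2 := by
  set A : ℝ := ∫ x in Ioi xf, f' x ^ 2 with hA
  have hA0 : 0 ≤ A := setIntegral_nonneg measurableSet_Ioi fun x _ => sq_nonneg _
  have hK0 : 0 ≤ K :=
    le_trans (mul_nonneg (sq_nonneg _) (hV0 (xf + 1))) (hVK (xf + 1) (by linarith))
  have hfc : Continuous f := continuous_iff_continuousAt.2 fun x => (hf x).continuousAt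
  have hgc : Continuous fun x => V x * f x ^ 2 := hV.mul (hfc.pow 2)
  -- step 1: the interval bound for `xf < x₁ ≤ x₂`
  have hstep : ∀ x₁ x₂, xf < x₁ → x₁ ≤ x₂ →
      (∫ x in x₁..x₂, V x * f x ^ 2) ≤ K * (2 * (f x₁ ^ 2 / (x₁ - xf)) + 4 * A) := by
    intro x₁ x₂ h1 h12
    have hr₁ : 0 < x₁ - xf := by linarith
    have hr : x₁ - xf ≤ x₂ - xf := by linarith
    have hH := hardy_sq_interval_le (Φ := fun r => f (xf + r)) (Φ' := fun r => f' (xf + r)) hr₁ hr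
      (fun r _ => HasDerivAt.comp_const_add xf r (hf (xf + r)))
      ((hf'c.comp (continuous_const.add continuous_id)).continuousOn)
    have hI1 : (∫ r in (x₁ - xf)..(x₂ - xf), f' (xf + r) ^ 2) = ∫ x in x₁..x₂, f' x ^ 2 := by
      rw [intervalIntegral.integral_comp_add_left (fun x => f' x ^ 2) xf]
      congr 1 <;> ring
    have hI1le : (∫ x in x₁..x₂, f' x ^ 2) ≤ A := by
      rw [intervalIntegral.integral_of_le h12]
      exact setIntegral_mono_set hiA (ae_of_all _ fun x => sq_nonneg _)
        (ae_of_all _ fun x hx => lt_trans h1 hx.1)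
    have hedge : 0 ≤ f (xf + (x₂ - xf)) ^ 2 / (x₂ - xf) := div_nonneg (sq_nonneg _) (by linarith)
    have hJ : (∫ r in (x₁ - xf)..(x₂ - xf), f (xf + r) ^ 2 / r ^ 2)
        ≤ 2 * (f x₁ ^ 2 / (x₁ - xf)) + 4 * A := by
      rw [hI1, show xf + (x₁ - xf) = x₁ by ring] at hH
      linarith
    have hcmp : (∫ x in x₁..x₂, V x * f x ^ 2)
        = ∫ r in (x₁ - xf)..(x₂ - xf), V (xf + r) * f (xf + r) ^ 2 := by
      rw [intervalIntegral.integral_comp_add_left (fun x => V x * f x ^ 2) xf]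
      congr 1 <;> ring
    have hpt : ∀ r ∈ Icc (x₁ - xf) (x₂ - xf),
        V (xf + r) * f (xf + r) ^ 2 ≤ K * (f (xf + r) ^ 2 / r ^ 2) := by
      intro r hr'
      have hr0 : 0 < r := lt_of_lt_of_le hr₁ hr'.1
      have h := hVK (xf + r) (by linarith)
      rw [show xf + r - xf = r by ring] at h
      have hVle : V (xf + r) ≤ K / r ^ 2 := by
        rw [le_div_iff₀ (by positivity)]; linarith
      calc V (xf + r) * f (xf + r) ^ 2 ≤ K / r ^ 2 * f (xf + r) ^ 2 :=
            mul_le_mul_of_nonneg_right hVle (sq_nonneg _)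
        _ = K * (f (xf + r) ^ 2 / r ^ 2) := by ring
    have hc1 : Continuous fun r => V (xf + r) * f (xf + r) ^ 2 :=
      hgc.comp (continuous_const.add continuous_id)
    have hc2 : ContinuousOn (fun r => K * (f (xf + r) ^ 2 / r ^ 2)) (Icc (x₁ - xf) (x₂ - xf)) := by
      refine continuousOn_const.mul (ContinuousOn.div ?_ ?_ fun r hr' => ?_)
      · exact ((hfc.comp (continuous_const.add continuous_id)).pow 2).continuousOn
      · exact (continuous_id.pow 2).continuousOn
      · exact pow_ne_zero 2 (lt_of_lt_of_le hr₁ hr'.1).ne'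
    calc (∫ x in x₁..x₂, V x * f x ^ 2)
        = ∫ r in (x₁ - xf)..(x₂ - xf), V (xf + r) * f (xf + r) ^ 2 := hcmp
      _ ≤ ∫ r in (x₁ - xf)..(x₂ - xf), K * (f (xf + r) ^ 2 / r ^ 2) :=
          intervalIntegral.integral_mono_on hr (hc1.intervalIntegrable _ _)
            (hc2.intervalIntegrable_of_Icc hr) hpt
      _ = K * ∫ r in (x₁ - xf)..(x₂ - xf), f (xf + r) ^ 2 / r ^ 2 :=
          intervalIntegral.integral_const_mul _ _
      _ ≤ K * (2 * (f x₁ ^ 2 / (x₁ - xf)) + 4 * A) := mul_le_mul_of_nonneg_left hJ hK0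
  -- step 2: the edge term vanishes as `x₁ → xf⁺`
  have hlim0 : Tendsto (fun x₁ => f x₁ ^ 2 / (x₁ - xf)) (𝓝[>] xf) (𝓝 0) := by
    have h1 : Tendsto (slope f xf) (𝓝[>] xf) (𝓝 (f' xf)) :=
      (hf xf).tendsto_slope.mono_left (nhdsGT_le_nhdsNE xf)
    have h2 : Tendsto f (𝓝[>] xf) (𝓝 0) := by
      have := (hfc.tendsto xf).mono_left (nhdsWithin_le_nhds (s := Ioi xf))
      rwa [hf0] at this
    have h3 := h1.mul h2
    rw [mul_zero] at h3
    refine h3.congr' ?_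
    filter_upwards [self_mem_nhdsWithin] with x₁ hx₁
    have hne : x₁ - xf ≠ 0 := sub_ne_zero.2 (ne_of_gt hx₁)
    rw [slope_def_field, hf0, sub_zero]
    field_simp
  have hstep2 : ∀ x₂, xf < x₂ → (∫ x in xf..x₂, V x * f x ^ 2) ≤ K * (4 * A) := by
    intro x₂ hx₂
    have hii : ∀ a b, IntervalIntegrable (fun x => V x * f x ^ 2) volume a b :=
      fun a b => hgc.intervalIntegrable a b
    have hcont : Continuous fun x₁ => ∫ x in x₁..x₂, V x * f x ^ 2 := by
      refine (intervalIntegral.continuous_primitive hii x₂).neg.congr fun x₁ => ?_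
      rw [intervalIntegral.integral_symm]
      rfl
    have hL : Tendsto (fun x₁ => ∫ x in x₁..x₂, V x * f x ^ 2) (𝓝[>] xf)
        (𝓝 (∫ x in xf..x₂, V x * f x ^ 2)) :=
      (hcont.tendsto xf).mono_left nhdsWithin_le_nhds
    have hR : Tendsto (fun x₁ => K * (2 * (f x₁ ^ 2 / (x₁ - xf)) + 4 * A)) (𝓝[>] xf)
        (𝓝 (K * (2 * 0 + 4 * A))) :=
      ((hlim0.const_mul 2).add tendsto_const_nhds).const_mul K
    rw [mul_zero, zero_add] at hR
    refine le_of_tendsto_of_tendsto hL hR ?_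
    filter_upwards [Ioc_mem_nhdsGT hx₂] with x₁ hx₁
    exact hstep x₁ x₂ hx₁.1 hx₁.2
  -- step 3: `x₂ → ∞`
  have hlim := intervalIntegral_tendsto_integral_Ioi xf hiB tendsto_id
  have hle : (∫ x in Ioi xf, V x * f x ^ 2) ≤ K * (4 * A) :=
    le_of_tendsto hlim (by
      filter_upwards [eventually_gt_atTop xf] with x₂ hx₂
      exact hstep2 x₂ hx₂)
  linarith

/-- Registered form of `hardy_ray` (sub-goal `stub_kernelOneHardy` of the crux item). -/
theorem stub_kernelOneHardy : ∀ (V f f' : ℝ → ℝ) (xf K : ℝ), Continuous V → (∀ x, 0 ≤ V x) →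
    (∀ x, xf < x → (x - xf) ^ 2 * V x ≤ K) → (∀ x, HasDerivAt f (f' x) x) → Continuous f' →
    f xf = 0 → IntegrableOn (fun x => f' x ^ 2) (Set.Ioi xf) →
    IntegrableOn (fun x => V x * f x ^ 2) (Set.Ioi xf) →
    ∫ x in Set.Ioi xf, V x * f x ^ 2 ≤ 4 * K * ∫ x in Set.Ioi xf, f' x ^ 2 :=
  fun _ _ _ _ _ hV hV0 hVK hf hf'c hf0 hiA hiB => hardy_ray hV hV0 hVK hf hf'c hf0 hiA hiB

end Summit.FinalStateConjecture.FinalStateConjecture.Theorems.CrumPeelingRecessiveTower
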